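import Literature.Computability.AlgebraicComplexity.OrbitClosure
import Mathlib

/-!
# Border apolarity, crux `FixedWitnessObstructionQP` — a Kuratowski limit of `d`-planes of degree-`k` forms is a `d`-plane

Route `ValiantsHypothesis/BorderApolarity`, crux item `stmt-ValiantsHypothesis-5778`, line
`cone-purity-squeeze`, stub `stub_kuratowskiSubmodule` (normal form N1 of the skeleton, the content
of the witness clauses W2 = (Li) and W3 = (Ls)): in the coefficient topology (`coeffVec`, product
topology on `(σ →₀ ℕ) → ℂ`), if `A t` (`t ∈ ℕ`) are subspaces of the degree-`k` forms in finitely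
many variables, all of dimension `d`, and `L` is their Kuratowski limit — (Li) every element of `L`
is a limit of elements `D_t ∈ A t`, (Ls) every subsequential limit of elements `D_t ∈ A (φ t)` lies
in `L` — then `L` is a linear subspace of the degree-`k` forms of dimension exactly `d` (closedness
of the Grassmannian).

Proof.
* `L ⊆ Hom_k`: a coefficient off degree `k` of `D ∈ L` is the limit of the corresponding
  coefficients of its approximants, which vanish (`mem_homogeneousSubmodule_of_tendsto`).
* `L` is a subspace: `0`, sums and scalar multiples of approximants are approximants, and (Ls)
  with `φ = id` (`exists_submodule_coe_eq`).
* Dimension: transport along the coordinate map `π : f ↦ (coeff e f)_{|e| = k}` to the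
  finite-dimensional normed space `{e // |e| = k} → ℂ` (`π` is injective on `Hom_k` and onto, a
  degree-`k` form being determined by its degree-`k` coefficients — `exists_coeff_eq`; product
  convergence of `coeffVec`s of degree-`k` forms is convergence of `π`-images).  There:
  `d ≤ finrank` (`le_finrank_of_kuratowski`, uses (Ls)): if the limit `M` were smaller, a
  complement `M'` of `M` meets every `d`-plane `B t` nontrivially by a dimension count; unit
  vectors in `B t ⊓ M'` have a convergent subsequence (compact unit sphere) whose limit lies in
  `M ⊓ M' = 0`, absurd.  `finrank ≤ d` (`finrank_le_of_kuratowski`, uses (Li)): `d + 1`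
  independent vectors of `M` have approximants in `B t`, independent for `t ≫ 0` because linear
  independence is an open condition (`isOpen_setOf_linearIndependent`), contradicting
  `finrank (B t) = d`.
-/

open MvPolynomial Filter
open scoped BigOperators Matrix
open Literature.Computability.AlgebraicComplexity

namespace Summit.ValiantsHypothesis.ValiantsHypothesis.Theorems.BorderApolarityFixedWitnessObstructionQP

/-! ## Kuratowski limits of `d`-planes in a finite-dimensional normed space -/

section Abstract

variable {E : Type*} [NormedAddCommGroup E] [NormedSpace ℂ E] [FiniteDimensional ℂ E]

/-- **Lower semicontinuity of dimension fails only upwards: `d ≤ dim M`.**  In a finite-dimensional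
complex normed space, if every `B t` is a `d`-dimensional subspace and the subspace `M` contains every
subsequential limit of sequences `x_t ∈ B (φ t)` (clause (Ls)), then `d ≤ finrank M`: otherwise a
complement `M'` of `M` meets each `B t` in a nonzero vector (dimension count), unit vectors there have
a convergent subsequence (compactness of the unit sphere), and its limit is a unit vector of
`M ⊓ M' = 0`. [folklore] -/
theorem le_finrank_of_kuratowski (d : ℕ) (B : ℕ → Submodule ℂ E) (M : Submodule ℂ E)
    (hd : ∀ t, Module.finrank ℂ (B t) = d)
    (hLs : ∀ (x : E) (φ : ℕ → ℕ) (xs : ℕ → E), StrictMono φ → (∀ t, xs t ∈ B (φ t)) →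
      Tendsto xs atTop (nhds x) → x ∈ M) :
    d ≤ Module.finrank ℂ M := by
  by_contra hlt
  push Not at hlt
  obtain ⟨M', hMM'⟩ := Submodule.exists_isCompl M
  have hdim : Module.finrank ℂ M + Module.finrank ℂ M' = Module.finrank ℂ E :=
    Submodule.finrank_add_eq_of_isCompl hMM'
  -- each `B t` meets the complement `M'` nontrivially
  have hne : ∀ t, B t ⊓ M' ≠ ⊥ := by
    intro t hbot
    have h1 := Submodule.finrank_sup_add_finrank_inf_eq (B t) M'
    rw [hbot, finrank_bot, add_zero, hd] at h1
    have h2 : Module.finrank ℂ ↥(B t ⊔ M') ≤ Module.finrank ℂ E := Submodule.finrank_le _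
    omega
  -- unit vectors in `B t ⊓ M'`
  have hv : ∀ t, ∃ v : E, v ∈ B t ∧ v ∈ M' ∧ ‖v‖ = 1 := by
    intro t
    obtain ⟨w, hw, hw0⟩ := (Submodule.ne_bot_iff _).1 (hne t)
    obtain ⟨hwB, hwM'⟩ := Submodule.mem_inf.1 hw
    have hn : ‖w‖ ≠ 0 := norm_ne_zero_iff.2 hw0
    refine ⟨((‖w‖ : ℝ) : ℂ)⁻¹ • w, Submodule.smul_mem _ _ hwB, Submodule.smul_mem _ _ hwM', ?_⟩
    rw [norm_smul, norm_inv, Complex.norm_real, norm_norm, inv_mul_cancel₀ hn]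
  choose v hvB hvM' hv1 using hv
  have hvs : ∀ t, v t ∈ Metric.sphere (0 : E) 1 := fun t => mem_sphere_zero_iff_norm.2 (hv1 t)
  haveI : ProperSpace E := FiniteDimensional.proper ℂ E
  obtain ⟨u, hu, φ, hφ, hlim⟩ := (isCompact_sphere (0 : E) 1).tendsto_subseq hvs
  have hlim' : Tendsto (fun t => v (φ t)) atTop (nhds u) := hlim
  have huM' : u ∈ M' :=
    (M'.closed_of_finiteDimensional).mem_of_tendsto hlim'
      (Eventually.of_forall fun t => hvM' (φ t))
  have huM : u ∈ M := hLs u φ (fun t => v (φ t)) hφ (fun t => hvB (φ t)) hlim'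
  have hu0 : u = 0 := by
    have h := Submodule.mem_inf.2 ⟨huM, huM'⟩
    rwa [hMM'.inf_eq_bot, Submodule.mem_bot] at h
  rw [hu0, mem_sphere_zero_iff_norm, norm_zero] at hu
  exact zero_ne_one hu

/-- **`dim M ≤ d`.**  In a finite-dimensional complex normed space, if every `B t` is a
`d`-dimensional subspace and every element of the subspace `M` is a limit of a sequence `x_t ∈ B t`
(clause (Li)), then `finrank M ≤ d`: `d + 1` independent vectors of `M` have approximants in `B t`
which are independent for `t ≫ 0`, linear independence being an open condition
(`isOpen_setOf_linearIndependent`), contradicting `finrank (B t) = d`. [folklore] -/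
theorem finrank_le_of_kuratowski (d : ℕ) (B : ℕ → Submodule ℂ E) (M : Submodule ℂ E)
    (hd : ∀ t, Module.finrank ℂ (B t) = d)
    (hLi : ∀ x ∈ M, ∃ xs : ℕ → E, (∀ t, xs t ∈ B t) ∧ Tendsto xs atTop (nhds x)) :
    Module.finrank ℂ M ≤ d := by
  by_contra hlt
  push Not at hlt
  obtain ⟨w, hw⟩ := exists_linearIndependent_of_le_finrank (R := ℂ) (M := ↥M) (n := d + 1) hlt
  have hw' : LinearIndependent ℂ (fun i => (w i : E)) := hw.map' M.subtype M.ker_subtype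
  have hxs : ∀ i, ∃ xs : ℕ → E, (∀ t, xs t ∈ B t) ∧ Tendsto xs atTop (nhds (w i : E)) :=
    fun i => hLi _ (w i).2
  choose xs hxsB hxs using hxs
  have hF : Tendsto (fun t i => xs i t) atTop (nhds fun i => (w i : E)) :=
    tendsto_pi_nhds.2 fun i => hxs i
  have hev : ∀ᶠ t in atTop, LinearIndependent ℂ (fun i => xs i t) :=
    hF.eventually_mem (isOpen_setOf_linearIndependent.mem_nhds hw')
  obtain ⟨t, ht⟩ := hev.exists
  have hind : LinearIndependent ℂ (fun i => (⟨xs i t, hxsB i t⟩ : B t)) :=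
    LinearIndependent.of_comp (B t).subtype ht
  have hcard := hind.fintype_card_le_finrank
  rw [Fintype.card_fin, hd] at hcard
  omega

end Abstract

/-! ## Degree-`k` forms in the coefficient topology -/

section Forms

variable {σ : Type*}

/-- A coefficientwise limit of degree-`k` forms is a degree-`k` form: a coefficient off degree `k`
of the limit is the limit of the corresponding coefficients of the approximants, which vanish.
[folklore] -/
theorem mem_homogeneousSubmodule_of_tendsto (k : ℕ) {D : MvPolynomial σ ℂ}
    {Ds : ℕ → MvPolynomial σ ℂ} (hDs : ∀ t, Ds t ∈ MvPolynomial.homogeneousSubmodule σ ℂ k)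
    (hlim : Tendsto (fun t => coeffVec (Ds t)) atTop (nhds (coeffVec D))) :
    D ∈ MvPolynomial.homogeneousSubmodule σ ℂ k := by
  rw [mem_homogeneousSubmodule]
  have hcoeff : ∀ m : σ →₀ ℕ, m.degree ≠ k → MvPolynomial.coeff m D = 0 := by
    intro m hm
    have h1 : Tendsto (fun t => coeffVec (Ds t) m) atTop (nhds (coeffVec D m)) :=
      (continuous_apply m).continuousAt.tendsto.comp hlim
    have h2 : (fun t => coeffVec (Ds t) m) = fun _ => 0 := by
      funext t
      exact ((mem_homogeneousSubmodule k (Ds t)).1 (hDs t)).coeff_eq_zero hm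
    rw [h2] at h1
    exact tendsto_nhds_unique h1 tendsto_const_nhds
  intro m hm
  by_contra hne
  exact hm (hcoeff m (by rwa [Finsupp.degree_eq_weight_one]))

/-- The Kuratowski limit `L` of a sequence of subspaces `A t` — (Li) every element of `L` is a
coefficientwise limit of elements `D_t ∈ A t`, (Ls) every subsequential limit of elements
`D_t ∈ A (φ t)` lies in `L` — is (the carrier of) a subspace: `0`, sums and scalar multiples of
approximants are approximants, and (Ls) along `φ = id` concludes. [folklore] -/
theorem exists_submodule_coe_eq (A : ℕ → Submodule ℂ (MvPolynomial σ ℂ))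
    (L : Set (MvPolynomial σ ℂ))
    (hLi : ∀ D ∈ L, ∃ Ds : ℕ → MvPolynomial σ ℂ, (∀ t, Ds t ∈ A t) ∧
      Tendsto (fun t => coeffVec (Ds t)) atTop (nhds (coeffVec D)))
    (hLs : ∀ (D : MvPolynomial σ ℂ) (φ : ℕ → ℕ) (Ds : ℕ → MvPolynomial σ ℂ), StrictMono φ →
      (∀ t, Ds t ∈ A (φ t)) → Tendsto (fun t => coeffVec (Ds t)) atTop (nhds (coeffVec D)) →
        D ∈ L) :
    ∃ Lk : Submodule ℂ (MvPolynomial σ ℂ), (Lk : Set (MvPolynomial σ ℂ)) = L := by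
  have hzero : (0 : MvPolynomial σ ℂ) ∈ L :=
    hLs 0 id (fun _ => 0) strictMono_id (fun t => Submodule.zero_mem _) tendsto_const_nhds
  have hadd : ∀ {D₁ D₂ : MvPolynomial σ ℂ}, D₁ ∈ L → D₂ ∈ L → D₁ + D₂ ∈ L := by
    intro D₁ D₂ h₁ h₂
    obtain ⟨Ds₁, hDs₁, hlim₁⟩ := hLi D₁ h₁
    obtain ⟨Ds₂, hDs₂, hlim₂⟩ := hLi D₂ h₂
    refine hLs (D₁ + D₂) id (fun t => Ds₁ t + Ds₂ t) strictMono_id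
      (fun t => Submodule.add_mem _ (hDs₁ t) (hDs₂ t)) ?_
    have key : ∀ f g : MvPolynomial σ ℂ, coeffVec (f + g) = coeffVec f + coeffVec g := by
      intro f g
      funext e
      simp only [coeffVec_apply, Pi.add_apply, coeff_add]
    simpa only [key] using hlim₁.add hlim₂
  have hsmul : ∀ (c : ℂ) {D : MvPolynomial σ ℂ}, D ∈ L → c • D ∈ L := by
    intro c D h
    obtain ⟨Ds, hDs, hlim⟩ := hLi D h
    refine hLs (c • D) id (fun t => c • Ds t) strictMono_id
      (fun t => Submodule.smul_mem _ c (hDs t)) ?_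
    have key : ∀ f : MvPolynomial σ ℂ, coeffVec (c • f) = c • coeffVec f := by
      intro f
      funext e
      simp only [coeffVec_apply, Pi.smul_apply, coeff_smul]
    simpa only [key] using hlim.const_smul c
  exact ⟨{ carrier := L, add_mem' := hadd, zero_mem' := hzero, smul_mem' := hsmul }, rfl⟩

/-- Every vector of prescribed degree-`k` coefficients is realised by a degree-`k` form (namely
`Σ_e monomial e (x e)`): the coordinate map `f ↦ (coeff e f)_{|e| = k}` is onto from `Hom_k`.
[folklore] -/
theorem exists_coeff_eq (k : ℕ) [Fintype {e : σ →₀ ℕ // e.degree = k}]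
    (x : {e : σ →₀ ℕ // e.degree = k} → ℂ) :
    ∃ D : MvPolynomial σ ℂ, D ∈ MvPolynomial.homogeneousSubmodule σ ℂ k ∧
      ∀ e : {e : σ →₀ ℕ // e.degree = k}, coeff e.1 D = x e := by
  classical
  refine ⟨∑ e : {e : σ →₀ ℕ // e.degree = k}, monomial e.1 (x e), ?_, ?_⟩
  · refine Submodule.sum_mem _ fun e _ => ?_
    rw [mem_homogeneousSubmodule]
    exact isHomogeneous_monomial _ e.2
  · intro e
    rw [coeff_sum, Finset.sum_eq_single e]
    · rw [coeff_monomial, if_pos rfl]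
    · intro e' _ hne
      rw [coeff_monomial, if_neg]
      exact fun h => hne (Subtype.ext h)
    · intro h
      exact absurd (Finset.mem_univ e) h

end Forms

/-! ## The stub -/

/-- **Kuratowski limits of `d`-planes of degree-`k` forms are `d`-planes (closedness of the
Grassmannian).**  In the coefficient topology (`coeffVec`, product topology), if `A t` (`t ∈ ℕ`) are
subspaces of the degree-`k` forms in finitely many variables, all of dimension `d`, and `L` is their
Kuratowski limit — (Li) every element of `L` is a limit of elements `D_t ∈ A t`, (Ls) every
subsequential limit of elements `D_t ∈ A (φ t)` lies in `L` — then `L` is a linear subspace of the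
degree-`k` forms of dimension exactly `d`: `≥ d` by compactness of the unit sphere of the
finite-dimensional coordinate space of `Hom_k` (this is where (Ls) is load-bearing), `≤ d` because
`d + 1` independent limits have independent approximants for `t ≫ 0` (openness of linear
independence; uses (Li)). [folklore] -/
theorem stub_kuratowskiSubmodule {σ : Type} [Fintype σ] (k d : ℕ)
    (A : ℕ → Submodule ℂ (MvPolynomial σ ℂ)) (L : Set (MvPolynomial σ ℂ))
    (hA : ∀ t, A t ≤ MvPolynomial.homogeneousSubmodule σ ℂ k)
    (hd : ∀ t, Module.finrank ℂ (A t) = d)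
    (hLi : ∀ D ∈ L, ∃ Ds : ℕ → MvPolynomial σ ℂ, (∀ t, Ds t ∈ A t) ∧
      Tendsto (fun t => coeffVec (Ds t)) atTop (nhds (coeffVec D)))
    (hLs : ∀ (D : MvPolynomial σ ℂ) (φ : ℕ → ℕ) (Ds : ℕ → MvPolynomial σ ℂ), StrictMono φ →
      (∀ t, Ds t ∈ A (φ t)) → Tendsto (fun t => coeffVec (Ds t)) atTop (nhds (coeffVec D)) → D ∈ L) :
    ∃ Lk : Submodule ℂ (MvPolynomial σ ℂ), (Lk : Set (MvPolynomial σ ℂ)) = L ∧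
      Lk ≤ MvPolynomial.homogeneousSubmodule σ ℂ k ∧ Module.finrank ℂ Lk = d := by
  classical
  obtain ⟨Lk, hLk⟩ := exists_submodule_coe_eq A L hLi hLs
  have hmemLk : ∀ D, D ∈ Lk ↔ D ∈ L := fun D => by rw [← SetLike.mem_coe, hLk]
  have hLkhom : Lk ≤ MvPolynomial.homogeneousSubmodule σ ℂ k := by
    intro D hD
    obtain ⟨Ds, hDs, hlim⟩ := hLi D ((hmemLk D).1 hD)
    exact mem_homogeneousSubmodule_of_tendsto k (fun t => hA t (hDs t)) hlim
  refine ⟨Lk, hLk, hLkhom, ?_⟩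
  -- coordinates: the degree-`k` exponents, a finite type
  haveI : Fintype {e : σ →₀ ℕ // e.degree = k} :=
    Fintype.subtype ((Finset.univ : Finset σ).finsuppAntidiag k) fun e => by
      simp [Finset.mem_finsuppAntidiag, Finsupp.degree_eq_sum]
  -- the coordinate map `π f = (coeff e f)_{|e| = k}`
  obtain ⟨π, hπ⟩ : ∃ π : MvPolynomial σ ℂ →ₗ[ℂ] ({e : σ →₀ ℕ // e.degree = k} → ℂ),
      ∀ f e, π f e = coeff e.1 f :=
    ⟨LinearMap.pi fun e => lcoeff ℂ e.1, fun _ _ => rfl⟩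
  -- `π` is injective on degree-`k` forms
  have hinj : ∀ f ∈ MvPolynomial.homogeneousSubmodule σ ℂ k, π f = 0 → f = 0 := by
    intro f hf h0
    ext e
    rw [coeff_zero]
    by_cases he : e.degree = k
    · have h := congrFun h0 ⟨e, he⟩
      rwa [hπ] at h
    · exact ((mem_homogeneousSubmodule k f).1 hf).coeff_eq_zero he
  -- hence `map π` preserves the dimension of subspaces of degree-`k` forms
  have hfin : ∀ p : Submodule ℂ (MvPolynomial σ ℂ), p ≤ MvPolynomial.homogeneousSubmodule σ ℂ k →
      Module.finrank ℂ (p.map π) = Module.finrank ℂ p := by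
    intro p hp
    rw [← LinearMap.range_domRestrict]
    apply LinearMap.finrank_range_of_inj
    intro x y hxy
    apply Subtype.ext
    have h := hinj (x.1 - y.1) (Submodule.sub_mem _ (hp x.2) (hp y.2))
      (by rw [map_sub, sub_eq_zero]; exact hxy)
    exact sub_eq_zero.1 h
  rw [← hfin Lk hLkhom]
  -- apply the abstract statement in the coordinate space
  refine le_antisymm
    (finrank_le_of_kuratowski d (fun t => (A t).map π) (Lk.map π)
      (fun t => (hfin (A t) (hA t)).trans (hd t)) ?_)
    (le_finrank_of_kuratowski d (fun t => (A t).map π) (Lk.map π)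
      (fun t => (hfin (A t) (hA t)).trans (hd t)) ?_)
  · -- (Li) transported along `π`
    intro x hx
    obtain ⟨D, hD, rfl⟩ := Submodule.mem_map.1 hx
    obtain ⟨Ds, hDs, hlim⟩ := hLi D ((hmemLk D).1 hD)
    refine ⟨fun t => π (Ds t), fun t => Submodule.mem_map_of_mem (hDs t), ?_⟩
    refine tendsto_pi_nhds.2 fun e => ?_
    have h1 : Tendsto (fun t => coeffVec (Ds t) e.1) atTop (nhds (coeffVec D e.1)) :=
      (continuous_apply e.1).continuousAt.tendsto.comp hlim
    simpa only [hπ, coeffVec_apply] using h1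
  · -- (Ls) transported along `π`: pull the sequence back to degree-`k` forms
    intro x φ xs hφ hxs hlim
    have hDs : ∀ t, ∃ D, D ∈ A (φ t) ∧ π D = xs t := fun t => Submodule.mem_map.1 (hxs t)
    choose Ds hDsA hDsπ using hDs
    obtain ⟨D, hDhom, hDx⟩ := exists_coeff_eq k x
    have hlim' : Tendsto (fun t => coeffVec (Ds t)) atTop (nhds (coeffVec D)) := by
      refine tendsto_pi_nhds.2 fun e => ?_
      by_cases he : e.degree = k
      · have h1 : Tendsto (fun t => xs t ⟨e, he⟩) atTop (nhds (x ⟨e, he⟩)) :=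
          (continuous_apply _).continuousAt.tendsto.comp hlim
        have h2 : (fun t => coeffVec (Ds t) e) = fun t => xs t ⟨e, he⟩ := by
          funext t
          rw [coeffVec_apply, ← hDsπ t, hπ]
        rw [h2, coeffVec_apply, hDx ⟨e, he⟩]
        exact h1
      · have h2 : (fun t => coeffVec (Ds t) e) = fun _ => 0 := by
          funext t
          exact ((mem_homogeneousSubmodule k _).1 (hA _ (hDsA t))).coeff_eq_zero he
        rw [h2, coeffVec_apply, ((mem_homogeneousSubmodule k D).1 hDhom).coeff_eq_zero he]
        exact tendsto_const_nhds
    have hDL : D ∈ Lk := (hmemLk D).2 (hLs D φ Ds hφ hDsA hlim')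
    refine Submodule.mem_map.2 ⟨D, hDL, ?_⟩
    funext e
    rw [hπ, hDx]

end Summit.ValiantsHypothesis.ValiantsHypothesis.Theorems.BorderApolarityFixedWitnessObstructionQP
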